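import Mathlib

/-!
# `QuadraticDigitPhases` (stmt-QuantumAdvantage-1391), line `Sketch` — stub `stub_lossCount` (loss-opportunity counting)

Pure `𝔽₂` linear algebra.  Far sources `b 0 < b 1 < ⋯ < b (g-1) < N`, coefficient pattern `a`,
cut matrix `M = (a i j · [i < N ≤ j])_{i,j<n}` of rank `< R₀`.  We show
`g ≤ (R₀ - 1) + #{dependent births} + #{deaths below N}`.

Proof.  In `V = (Fin n → ZMod 2)` let `𝐫[t] = (a (b t) j)_j` be the full row of the far source `t`,
`𝐞[c]` the unit vector of column `c` (zero if `c ≥ n`), and consider the increasing family of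
subspaces `𝐅[c, d] = span {𝐫[t] : t < g, b t < c} ⊔ span {𝐞[j] : j < min d n}` (all of these are
local notations for explicit terms, not definitions).
Every `x ∈ 𝐅[c, d]` satisfies `x j = Σ_{t<g, b t<c} w t · a (b t) j` for all columns `j ≥ d`, for
some `w : ℕ → ZMod 2` (`mem_filt`), and over `ZMod 2` such a combination is a subset sum
(`sum_mul_eq_sum_filter`).  Hence
* if `c < n` and `𝐞[c] ∈ 𝐅[c, c]` then column `c` *dies* (`death_of_unitVec_mem`), so
  `finrank 𝐅[c, c] + [c < n] ≤ finrank 𝐅[c, c+1] + [death c]`;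
* if `b t = c` and `𝐫[t] ∈ 𝐅[c, c+1]` then the birth `t` is *dependent* (`dep_of_rowVec_mem`: the
  far sources `< b t` are exactly the older ones, by monotonicity), so
  `finrank 𝐅[c, c+1] + [non-dependent birth at c] ≤ finrank 𝐅[c+1, c+1]`
  (strict inclusions raise `finrank`, `Submodule.finrank_lt_finrank_of_lt`).
By induction on `c` (`invariant`):
`#{t < g : ¬dep t, b t < c} + min c n ≤ finrank 𝐅[c, c] + #{c' < c : death c'}`.
Finally `𝐅[N, N] ≤ span (rows of M) ⊔ span {𝐞[j] : j < min N n}` (`finrank_filt_le`, via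
`Matrix.rank_eq_finrank_span_row`), so `finrank 𝐅[N, N] ≤ rank M + min N n < R₀ + min N n`, and
`g = #dep + #nondep` gives the claim.
-/

set_option linter.dupNamespace false -- D-0017: single-problem summit ⇒ `QuantumAdvantage.QuantumAdvantage` by design

namespace Summit.QuantumAdvantage.QuantumAdvantage.Theorems.MobiusLadderQuadraticDigitPhasesStubLossCount

open Finset Module

section LinearAlgebra

variable {n g : ℕ} {a : ℕ → ℕ → ZMod 2} {b : ℕ → ℕ}

/-- The full row of the far source `t`, as a vector indexed by the columns `j < n` (local notation). -/
local notation3 (prettyPrint := false) "𝐫[" t "]" => (fun j : Fin n => a (b t) (j : ℕ))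

/-- The unit vector of column `c`, the zero vector if `n ≤ c` (local notation). -/
local notation3 (prettyPrint := false) "𝐞[" c "]" =>
  (fun j : Fin n => if (j : ℕ) = c then (1 : ZMod 2) else 0)

/-- The span of the full rows of the far sources `t < g` with `b t < c` (local notation). -/
local notation3 (prettyPrint := false) "𝐑[" c "]" =>
  (Submodule.span (ZMod 2) ((fun t : ℕ => 𝐫[t]) '' {t : ℕ | t < g ∧ b t < c}))

/-- The span of the unit vectors of the columns `j < min d n` (local notation). -/
local notation3 (prettyPrint := false) "𝐔[" d "]" => (Submodule.span (ZMod 2)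
  ((((Finset.range (min d n)).image (fun c' : ℕ => 𝐞[c'])) : Finset (Fin n → ZMod 2)) :
    Set (Fin n → ZMod 2)))

/-- The filtration `𝐅[c, d] = 𝐑[c] ⊔ 𝐔[d]` (local notation). -/
local notation3 (prettyPrint := false) "𝐅[" c ", " d "]" =>
  (𝐑[c] ⊔ 𝐔[d] : Submodule (ZMod 2) (Fin n → ZMod 2))

/-- NON-DEPENDENT BIRTHS with source `< c`: the `t < g` with `b t < c` whose row beyond column `b t`
is not a subset sum of older far rows (local notation). -/
local notation3 (prettyPrint := false) "𝐍[" c "]" => ((Finset.range g).filter (fun t =>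
    ¬ (∃ S ∈ (Finset.range t).powerset,
      ∀ j ∈ Finset.range n, b t < j → a (b t) j = ∑ i ∈ S, a (b i) j) ∧ b t < c))

/-- DEATHS below `c`: the columns `c' < c` such that a nonempty subset sum of far rows with sources
`< c'` is, on the columns `≥ c'`, the unit vector of column `c'` (local notation). -/
local notation3 (prettyPrint := false) "𝐃[" c "]" => ((Finset.range c).filter (fun c' =>
    ∃ S ∈ (Finset.range g).powerset, S.Nonempty ∧ (∀ i ∈ S, b i < c') ∧ (∑ i ∈ S, a (b i) c' = 1) ∧
      ∀ j ∈ Finset.range n, c' < j → ∑ i ∈ S, a (b i) j = 0))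

/-- Over `ZMod 2` a linear combination is a subset sum. -/
theorem sum_mul_eq_sum_filter (T : Finset ℕ) (w f : ℕ → ZMod 2) :
    ∑ i ∈ T, w i * f i = ∑ i ∈ T.filter (fun i => w i = 1), f i := by
  rw [Finset.sum_filter]
  refine Finset.sum_congr rfl fun i _ => ?_
  have h01 : ∀ z : ZMod 2, z = 0 ∨ z = 1 := by decide
  rcases h01 (w i) with h | h <;> simp [h]

/-- Elements of `𝐑[c]` are linear combinations of the far rows with sources `< c`. -/
theorem mem_rowSpace {c : ℕ} {x : Fin n → ZMod 2} (hx : x ∈ 𝐑[c]) :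
    ∃ w : ℕ → ZMod 2, ∀ j : Fin n,
      x j = ∑ i ∈ (Finset.range g).filter (fun i => b i < c), w i * a (b i) j := by
  induction hx using Submodule.span_induction with
  | mem x hx =>
    obtain ⟨t, ⟨htg, htc⟩, rfl⟩ := hx
    refine ⟨fun i => if i = t then 1 else 0, fun j => ?_⟩
    simp only [ite_mul, one_mul, zero_mul, Finset.sum_ite_eq', Finset.mem_filter,
      Finset.mem_range]
    rw [if_pos ⟨htg, htc⟩]
  | zero => exact ⟨fun _ => 0, fun j => by simp⟩
  | add x y _ _ hx hy =>
    obtain ⟨w₁, h₁⟩ := hx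
    obtain ⟨w₂, h₂⟩ := hy
    exact ⟨fun i => w₁ i + w₂ i, fun j => by
      simp only [Pi.add_apply, h₁ j, h₂ j, add_mul, Finset.sum_add_distrib]⟩
  | smul r x _ hx =>
    obtain ⟨w, h⟩ := hx
    exact ⟨fun i => r * w i, fun j => by
      simp only [Pi.smul_apply, smul_eq_mul, h j, Finset.mul_sum, mul_assoc]⟩

/-- Elements of `𝐔[d]` vanish on the columns `≥ d`. -/
theorem unitSpace_apply {d : ℕ} {x : Fin n → ZMod 2} (hx : x ∈ 𝐔[d]) :
    ∀ j : Fin n, d ≤ (j : ℕ) → x j = 0 := by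
  induction hx using Submodule.span_induction with
  | mem x hx =>
    intro j hj
    rw [Finset.mem_coe, Finset.mem_image] at hx
    obtain ⟨c, hc, rfl⟩ := hx
    rw [Finset.mem_range] at hc
    have hne : (j : ℕ) ≠ c := by omega
    simp [hne]
  | zero => intro j _; rfl
  | add x y _ _ hx hy => intro j hj; simp [hx j hj, hy j hj]
  | smul r x _ hx => intro j hj; simp [hx j hj]

/-- KEY DESCRIPTION of `𝐅[c, d]`: beyond column `d` its elements are combinations of far rows `< c`. -/
theorem mem_filt {c d : ℕ} {x : Fin n → ZMod 2} (hx : x ∈ 𝐅[c, d]) :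
    ∃ w : ℕ → ZMod 2, ∀ j : Fin n, d ≤ (j : ℕ) →
      x j = ∑ i ∈ (Finset.range g).filter (fun i => b i < c), w i * a (b i) j := by
  rw [Submodule.mem_sup] at hx
  obtain ⟨y, hy, z, hz, rfl⟩ := hx
  obtain ⟨w, hw⟩ := mem_rowSpace hy
  exact ⟨w, fun j hj => by rw [Pi.add_apply, hw j, unitSpace_apply hz j hj, add_zero]⟩

/-- The filtration is increasing in both parameters. -/
theorem filt_mono {c c' d d' : ℕ} (hc : c ≤ c') (hd : d ≤ d') : 𝐅[c, d] ≤ 𝐅[c', d'] := by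
  refine sup_le_sup (Submodule.span_mono (Set.image_mono fun t ht => ⟨ht.1, lt_of_lt_of_le ht.2 hc⟩))
    (Submodule.span_mono ?_)
  exact Finset.coe_subset.mpr (Finset.image_subset_image
    (Finset.range_subset_range.mpr (min_le_min hd le_rfl)))

/-- The unit vector of column `c < n` lies in `𝐅[c', c+1]`. -/
theorem unitVec_mem {c : ℕ} (hc : c < n) (c' : ℕ) : 𝐞[c] ∈ 𝐅[c', c + 1] :=
  Submodule.mem_sup_right (Submodule.subset_span (Finset.mem_coe.mpr
    (Finset.mem_image_of_mem _ (Finset.mem_range.mpr (lt_min (Nat.lt_succ_self c) hc)))))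

/-- The row of a far source `t < g` with `b t < c` lies in `𝐅[c, d]`. -/
theorem rowVec_mem {t c : ℕ} (ht : t < g) (hc : b t < c) (d : ℕ) : 𝐫[t] ∈ 𝐅[c, d] :=
  Submodule.mem_sup_left (Submodule.subset_span ⟨t, ⟨ht, hc⟩, rfl⟩)

/-- DEATH CRITERION: if `c < n` and the unit vector of column `c` lies in `𝐅[c, c]`, column `c` dies. -/
theorem death_of_unitVec_mem {c : ℕ} (hc : c < n) (hmem : 𝐞[c] ∈ 𝐅[c, c]) : c ∈ 𝐃[c + 1] := by
  obtain ⟨w, hw⟩ := mem_filt hmem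
  set T := (Finset.range g).filter (fun i => b i < c) with hT
  refine Finset.mem_filter.mpr ⟨Finset.mem_range.mpr (Nat.lt_succ_self c),
    T.filter (fun i => w i = 1), ?_, ?_, ?_, ?_, ?_⟩
  · exact Finset.mem_powerset.mpr ((Finset.filter_subset _ _).trans (Finset.filter_subset _ _))
  · by_contra hS
    rw [Finset.not_nonempty_iff_eq_empty] at hS
    have h1 := hw ⟨c, hc⟩ le_rfl
    rw [sum_mul_eq_sum_filter, hS, Finset.sum_empty] at h1
    simp at h1
  · intro i hi
    simp only [hT, Finset.mem_filter, Finset.mem_range] at hi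
    exact hi.1.2
  · have h1 := hw ⟨c, hc⟩ le_rfl
    rw [sum_mul_eq_sum_filter] at h1
    simpa using h1.symm
  · intro j hj hcj
    rw [Finset.mem_range] at hj
    have h1 := hw ⟨j, hj⟩ hcj.le
    rw [sum_mul_eq_sum_filter] at h1
    have hne : j ≠ c := by omega
    simpa [hne] using h1.symm

/-- DEPENDENCE CRITERION: if the row of the far source `t` lies in `𝐅[b t, b t + 1]`, the birth
at `t` is dependent (the far sources `< b t` are exactly the older ones, by monotonicity). -/
theorem dep_of_rowVec_mem (hmono : ∀ t t', t < t' → t' < g → b t < b t') {t : ℕ}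
    (hmem : 𝐫[t] ∈ 𝐅[b t, b t + 1]) :
    ∃ S ∈ (Finset.range t).powerset, ∀ j ∈ Finset.range n, b t < j → a (b t) j = ∑ i ∈ S, a (b i) j := by
  obtain ⟨w, hw⟩ := mem_filt hmem
  set T := (Finset.range g).filter (fun i => b i < b t) with hT
  refine ⟨T.filter (fun i => w i = 1), ?_, ?_⟩
  · rw [Finset.mem_powerset]
    intro i hi
    simp only [hT, Finset.mem_filter, Finset.mem_range] at hi
    rw [Finset.mem_range]
    by_contra hit
    rcases (not_lt.mp hit).eq_or_lt with h | h
    · rw [h] at hi; exact lt_irrefl _ hi.1.2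
    · exact lt_asymm (hmono t i h hi.1.1) hi.1.2
  · intro j hj hbj
    rw [Finset.mem_range] at hj
    have h1 := hw ⟨j, hj⟩ (Nat.succ_le_of_lt hbj)
    rw [sum_mul_eq_sum_filter] at h1
    simpa using h1

/-- FINAL COMPARISON: `𝐅[N, N] ≤ span (rows of the cut matrix) ⊔ 𝐔[N]`, hence
`finrank 𝐅[N, N] ≤ rank + min N n`. -/
theorem finrank_filt_le (N : ℕ) :
    Module.finrank (ZMod 2) 𝐅[N, N] ≤
      (Matrix.of fun (i j : Fin n) => if (i : ℕ) < N ∧ N ≤ (j : ℕ) then a i j else 0).rank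
        + min N n := by
  set M : Matrix (Fin n) (Fin n) (ZMod 2) :=
    Matrix.of fun (i j : Fin n) => if (i : ℕ) < N ∧ N ≤ (j : ℕ) then a i j else 0 with hM
  -- vectors supported on the columns `< N` lie in `𝐔[N]`
  have hsupp : ∀ x : Fin n → ZMod 2, (∀ j : Fin n, N ≤ (j : ℕ) → x j = 0) → x ∈ 𝐔[N] := by
    intro x hx
    rw [pi_eq_sum_univ x]
    refine Submodule.sum_mem _ fun j _ => ?_
    by_cases hj : N ≤ (j : ℕ)
    · rw [hx j hj, zero_smul]; exact Submodule.zero_mem _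
    · refine Submodule.smul_mem _ _ (Submodule.subset_span ?_)
      rw [Finset.mem_coe, Finset.mem_image]
      refine ⟨j, Finset.mem_range.mpr (lt_min (not_le.mp hj) j.isLt), ?_⟩
      funext j'
      simp only [Fin.ext_iff]
      by_cases h : (j : ℕ) = (j' : ℕ)
      · rw [if_pos h.symm, if_pos h]
      · rw [if_neg (Ne.symm h), if_neg h]
  have hR : 𝐑[N] ≤ Submodule.span (ZMod 2) (Set.range M.row) ⊔ 𝐔[N] := by
    rw [Submodule.span_le]
    rintro _ ⟨t, ⟨-, htN⟩, rfl⟩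
    by_cases htn : b t < n
    · have hrow : M.row ⟨b t, htn⟩ ∈ Submodule.span (ZMod 2) (Set.range M.row) :=
        Submodule.subset_span ⟨_, rfl⟩
      have hdiff : 𝐫[t] - M.row ⟨b t, htn⟩ ∈ 𝐔[N] := by
        refine hsupp _ fun j hj => ?_
        simp [hM, htN, hj]
      have := Submodule.add_mem _ (Submodule.mem_sup_right hdiff) (Submodule.mem_sup_left hrow)
      simpa using this
    · exact Submodule.mem_sup_right (hsupp _ fun j hj => by exfalso; have := j.isLt; omega)
  have hle : 𝐅[N, N] ≤ Submodule.span (ZMod 2) (Set.range M.row) ⊔ 𝐔[N] :=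
    sup_le hR le_sup_right
  calc Module.finrank (ZMod 2) 𝐅[N, N]
      ≤ Module.finrank (ZMod 2)
          (Submodule.span (ZMod 2) (Set.range M.row) ⊔ 𝐔[N] : Submodule (ZMod 2) _) :=
        Submodule.finrank_mono hle
    _ ≤ Module.finrank (ZMod 2) (Submodule.span (ZMod 2) (Set.range M.row)) +
          Module.finrank (ZMod 2) 𝐔[N] :=
        Submodule.finrank_add_le_finrank_add_finrank _ _
    _ ≤ M.rank + min N n := by
        refine add_le_add (M.rank_eq_finrank_span_row).symm.le ?_
        exact (finrank_span_finset_le_card _).trans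
          (Finset.card_image_le.trans (Finset.card_range _).le)

/-- THE INVARIANT: `#{t < g : ¬dep t, b t < c} + min c n ≤ finrank 𝐅[c, c] + #{c' < c : death c'}`. -/
theorem invariant (hmono : ∀ t t', t < t' → t' < g → b t < b t') (c : ℕ) :
    (𝐍[c]).card + min c n ≤ Module.finrank (ZMod 2) 𝐅[c, c] + (𝐃[c]).card := by
  induction c with
  | zero => simp
  | succ c ih =>
    have hsub : 𝐍[c] ⊆ 𝐍[c + 1] := by
      intro t ht
      simp only [Finset.mem_filter] at ht ⊢
      exact ⟨ht.1, ht.2.1, Nat.lt_succ_of_lt ht.2.2⟩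
    -- the number of non-dependent births at `c` (0 or 1)
    set NB := (𝐍[c + 1] \ 𝐍[c]).card with hNB
    -- members of the difference are non-dependent births with source exactly `c`
    have hdiff : ∀ t ∈ 𝐍[c + 1] \ 𝐍[c], t < g ∧ b t = c ∧
        ¬ (∃ S ∈ (Finset.range t).powerset,
            ∀ j ∈ Finset.range n, b t < j → a (b t) j = ∑ i ∈ S, a (b i) j) := by
      intro t ht
      rw [Finset.mem_sdiff] at ht
      obtain ⟨ht1, hnot⟩ := ht
      rw [Finset.mem_filter, Finset.mem_range] at ht1
      obtain ⟨htg, hnd, hlt⟩ := ht1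
      have hge : ¬ b t < c := fun h =>
        hnot (Finset.mem_filter.mpr ⟨Finset.mem_range.mpr htg, hnd, h⟩)
      exact ⟨htg, by omega, hnd⟩
    have h1 : (𝐍[c + 1]).card ≤ (𝐍[c]).card + NB := by
      have := Finset.card_sdiff_add_card_eq_card hsub
      omega
    have h2 : NB ≤ 1 := by
      refine Finset.card_le_one.mpr fun t ht t' ht' => ?_
      obtain ⟨htg, hbt, -⟩ := hdiff t ht
      obtain ⟨htg', hbt', -⟩ := hdiff t' ht'
      by_contra hne
      rcases lt_or_gt_of_ne hne with h | h
      · have := hmono t t' h htg'; omega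
      · have := hmono t' t h htg; omega
    have h3 : Module.finrank (ZMod 2) 𝐅[c, c + 1] + NB ≤ Module.finrank (ZMod 2) 𝐅[c + 1, c + 1] := by
      by_cases hNB0 : NB = 0
      · rw [hNB0, add_zero]
        exact Submodule.finrank_mono (filt_mono (Nat.le_succ c) le_rfl)
      · obtain ⟨t, ht⟩ := Finset.card_ne_zero.mp hNB0
        obtain ⟨htg, hbt, hnd⟩ := hdiff t ht
        have hlt : 𝐅[c, c + 1] < 𝐅[c + 1, c + 1] := by
          refine SetLike.lt_iff_le_and_exists.mpr ⟨filt_mono (Nat.le_succ c) le_rfl,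
            𝐫[t], rowVec_mem htg (by omega) _, fun hmem => hnd ?_⟩
          rw [← hbt] at hmem
          exact dep_of_rowVec_mem hmono hmem
        have := Submodule.finrank_lt_finrank_of_lt hlt
        omega
    have h4 : Module.finrank (ZMod 2) 𝐅[c, c] + (if c < n then 1 else 0) + (𝐃[c]).card ≤
        Module.finrank (ZMod 2) 𝐅[c, c + 1] + (𝐃[c + 1]).card := by
      have hle : Module.finrank (ZMod 2) 𝐅[c, c] ≤ Module.finrank (ZMod 2) 𝐅[c, c + 1] :=
        Submodule.finrank_mono (filt_mono le_rfl (Nat.le_succ c))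
      have hsubD : 𝐃[c] ⊆ 𝐃[c + 1] := by
        intro c' h
        simp only [Finset.mem_filter, Finset.mem_range] at h ⊢
        exact ⟨Nat.lt_succ_of_lt h.1, h.2⟩
      have hcardD := Finset.card_le_card hsubD
      by_cases hc : c < n
      · rw [if_pos hc]
        by_cases hd : c ∈ 𝐃[c + 1]
        · have hins : insert c 𝐃[c] ⊆ 𝐃[c + 1] := Finset.insert_subset hd hsubD
          have hc' : c ∉ 𝐃[c] := by simp
          have := Finset.card_le_card hins
          rw [Finset.card_insert_of_notMem hc'] at this
          omega
        · have hlt : 𝐅[c, c] < 𝐅[c, c + 1] :=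
            SetLike.lt_iff_le_and_exists.mpr ⟨filt_mono le_rfl (Nat.le_succ c), 𝐞[c],
              unitVec_mem hc c, fun hmem => hd (death_of_unitVec_mem hc hmem)⟩
          have := Submodule.finrank_lt_finrank_of_lt hlt
          omega
      · rw [if_neg hc]
        omega
    have h6 : min (c + 1) n = min c n + (if c < n then 1 else 0) := by
      split_ifs <;> omega
    split_ifs at h4 h6 <;> omega

end LinearAlgebra

/-- LOSS-OPPORTUNITY COUNTING (registered stub `stub_lossCount` of crux stmt-QuantumAdvantage-1391, line Sketch, skeleton v27):
`g ≤ (R₀ − 1) + #dependent births + #deaths below N` for strictly increasing far sources below `N` and cut rank `< R₀` at `N`. -/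
theorem stub_lossCount :
    ∀ (n N R₀ g : ℕ) (a : ℕ → ℕ → ZMod 2) (b : ℕ → ℕ),
      (Matrix.of fun (i j : Fin n) => if (i : ℕ) < N ∧ N ≤ (j : ℕ) then a i j else 0).rank < R₀ →
      (∀ t, t < g → b t < N) → (∀ t t', t < t' → t' < g → b t < b t') →
      g ≤ (R₀ - 1) + ((Finset.range g).filter (fun t => (∃ S ∈ (Finset.range t).powerset, ∀ j ∈ Finset.range n, b t < j → a (b t) j = ∑ i ∈ S, a (b i) j))).card + ((Finset.range N).filter (fun c => (∃ S ∈ (Finset.range g).powerset, S.Nonempty ∧ (∀ i ∈ S, b i < c) ∧ (∑ i ∈ S, a (b i) c = 1) ∧ ∀ j ∈ Finset.range n, c < j → ∑ i ∈ S, a (b i) j = 0))).card := by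
  intro n N R₀ g a b hrank hbN hmono
  have hinv := invariant (n := n) (a := a) hmono N
  -- every far source is `< N`, so the non-dependent births with source `< N` are all of them
  have hA : (Finset.range g).filter (fun t => ¬ (∃ S ∈ (Finset.range t).powerset,
        ∀ j ∈ Finset.range n, b t < j → a (b t) j = ∑ i ∈ S, a (b i) j) ∧ b t < N) =
      (Finset.range g).filter (fun t => ¬ (∃ S ∈ (Finset.range t).powerset,
        ∀ j ∈ Finset.range n, b t < j → a (b t) j = ∑ i ∈ S, a (b i) j)) :=
    Finset.filter_congr fun t ht => and_iff_left (hbN t (Finset.mem_range.mp ht))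
  have hsplit := Finset.card_filter_add_card_filter_not (s := Finset.range g) (fun t =>
    ∃ S ∈ (Finset.range t).powerset, ∀ j ∈ Finset.range n, b t < j → a (b t) j = ∑ i ∈ S, a (b i) j)
  rw [Finset.card_range, ← hA] at hsplit
  have hfin := finrank_filt_le (n := n) (g := g) (a := a) (b := b) N
  omega

end Summit.QuantumAdvantage.QuantumAdvantage.Theorems.MobiusLadderQuadraticDigitPhasesStubLossCount
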